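import Summits.BirchSwinnertonDyer.BirchSwinnertonDyer.Theses.ByReductionTypeAtTwo
import Summits.BirchSwinnertonDyer.BirchSwinnertonDyer.Theorems.ByReductionTypeAtTwoSupersingularUniformFlatLine
import Summits.BirchSwinnertonDyer.BirchSwinnertonDyer.Theorems.ByReductionTypeAtTwoSupersingularNoPollackPair
import HarnessLib

/-!
# Line `flat_uniform_two` (v1, 2026-08-27; written by seat `bsd-2adic-ss-1` GEN 10, REGISTERED by GEN 12 per planner
# RC-176 (3) «adoption approved in substance; registration is for the 19097 crux-lane seat») — skeleton for crux
# `SupersingularRankZeroAtTwo` (item stmt-BirchSwinnertonDyer-19097, route ByReductionTypeAtTwo, rung K4); supersedes the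
# registered line `signed_halves_two` v9 (9 stubs, GEN 10), which stays in `Cruxes/…/Lines/signed_halves_two.lean` as history.

The crux from FIVE stubs, every good-supersingular curve at `2` (a₂ ∈ {0, ±2}) on Sprung's ♭ Coleman road:
(1) `stub_ssPub` (modularity ∧ GZK, PUB), (1′) `stub_katoPub` (Kato 12.4 (2) ∧ 12.4 (1) ∘ (17.13.1), PUB),
(2) `stub_allFlatData` — ∃ local data `(g, c)` at `v ∋ 2` with the Honda₂ clauses (levels, `n ≥ 1` trace relation,
level-`0` generation on `c_0 = d_0 = [−c♭]ε`) ∧ COUNT♭@2 (Sprung 2024 L5.5 on Sel♭ at 2) ∧ CK♭@2 — for ALL `a₂`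
(= v9's `stub_pmFlatDataV9` without the `a₂ = ±2` guard), (2′) `stub_allMuFlatOfNonSurj` — the guarded μ♭ = 0 stub
for ALL `a₂` (CONJ; non-surjective image: 2/208 a₂ = 0 classes, 0/549 a₂ = ±2), (3) `stub_allMillerLower` — Miller's
lower half `ord₂ #Ш_an ≤ ord₂ #Ш` for ALL curves of the crux (certificate-shaped per class, conjecture-shaped as ∀).
Composition `SupersingularRankZeroAtTwo_of` := `SSFlatRoad.supersingularRankZeroAtTwo_of_uniformFlatLine` (landed,
GEN 10) — EC♭@2 PRODUCED for every `a₂` by `SSFlatRoad.flatEulerChar_two`, the Kato half by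
`missingUpperBoundAt_two_of_flatUpper` (`c♭ = −a₂²+2a₂+1` a unit for all `a₂ ∈ {0, ±2}`). TRADE vs v9 on the `a₂ = 0`
sub-row (208 classes): {Kim EC@2 + (LAG)⁺ (R/memo), `KobayashiLowerDivisibility W 2 1` (MATH-BOUND ∀), CK± (F1 R/memo,
F3 P-at-2)} ↦ {COUNT♭@2, CK♭ (F1♭ FORMAL+PRINT-at-2, F3♭ READ-AT-2), Miller lower}. Adoption condition of RC-147 (1)
MET (audit-1 ♭ sheet ADD-3 b0e8d490; referee C R750/751; X5SS-FLAT ADDENDUM-2 «A2ZERO-♭» booked A2 R817): the 757 r0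
census classes (549 a₂ = ±2 + 208 a₂ = 0) are ALL displayed on this road. HONEST TAG after registration (unchanged in
substance from v9): PRINT-at-2 {Sprung Thm 2.2 (2′), Col §§2–6, Sprung pair, c♭ unit} + THEOREM {Lemma 2.3@2, Col♭ onto,
r₂ injective, L5.8·5.9@2, EC♭@2, COUNT♭ ∣-half/unpacking/chase} + PUB-COMPOSITE {COUNT♭@2 residue: Cassels/Tate/HS at
layer 0, RC-176 (2)} + READ-AT-2 {F1♭, F3♭} + P {F4rat} + P-ASSERT {F4@(2)} + CONJ {μ♭ = 0 off surjective image (2′),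
Miller lower as ∀ (3)}; BSD is not proved by any of this.
-/

set_option autoImplicit false
-- the Cruxes namespace of this sub repeats the summit name by design (D-0017 nested layout)
set_option linter.dupNamespace false

open scoped NumberField

open CongruenceSubgroup WeierstrassCurve Literature.NumberTheory.EllipticCurves
  Literature.NumberTheory.EllipticCurves.ModularForms
  Literature.NumberTheory.EllipticCurves.Rank1Residual Literature.NumberTheory.EllipticCurves.Rank1Residual.Typed
  Literature.NumberTheory.EllipticCurves.Kobayashi2003 Literature.NumberTheory.EllipticCurves.Sprung2012
  Literature.NumberTheory.EllipticCurves.Sprung2017 Literature.NumberTheory.EllipticCurves.IwasawaDual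
  Literature.NumberTheory.GaloisRepresentations ZpExtension NumberField IsDedekindDomain
  Summit.BirchSwinnertonDyer.Rank1Residual.Supersingular Summit.BirchSwinnertonDyer.Rank1Residual.X5.O1

namespace Summit.BirchSwinnertonDyer.BirchSwinnertonDyer.Cruxes.SupersingularRankZeroAtTwo

namespace FlatUniformTwo

/-- stub (1): the two PUBLISHED inputs, modularity ∧ GZK (closed by citation; route items 19266 / 19921). -/
theorem stub_ssPub :
    nonempty_modularParametrizationData ∧ rank_eq_analyticRank_of_analyticRank_le_one := by
  sorry

/-- stub (1′): PUBLISHED — Kato, Astérisque 295 Thm. 12.4 (2) and Thm. 12.4 (1) ∘ (17.13.1): the tree's two accepted named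
facts, any `p`. Closed by citation. -/
theorem stub_katoPub : Kato2004.thm12_4 ∧ Kato2004_fineSelmerDual_isTorsion := by
  sorry

/-- stub (2): EVERY good-supersingular curve at `2` — THE ♭ COLEMAN ROAD, DATA + COUNT + PACKAGE: ∃ local data `(g, c)`
at `v ∋ 2` (in print: the Δ-traced Honda system of Sprung's Thm. 2.2 at `p = 2`) with the Honda₂ clauses (levels,
`n ≥ 1` trace relation, level-`0` generation ON `c_0`) ∧ COUNT♭@2 (Sprung 2024 Lemma 5.5 on Sel♭ at 2: the real-place
line) ∧ CK♭@2 (F1♭ · F3♭ · F4rat · `TwoAdicSurjective W →` F4@(2)). EC♭@2 follows in the kernel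
(`SSFlatRoad.flatEulerChar_two`). -/
theorem stub_allFlatData :
      ∀ (W : WeierstrassCurve ℚ) [W.IsElliptic] [W.IsGloballyMinimal],
      ¬ W.HasCM → W.analyticRank = 0 → GoodSS W 2 →
      ∀ (κ : ZpExtension ℚ 2) (γ : Field.absoluteGaloisGroup ℚ),
        κ.IsCyclotomic → κ.IsTopGenerator γ → IsCyclotomicVariable 2 γ →
      ∀ (v : HeightOneSpectrum (𝓞 ℚ)), (2 : 𝓞 ℚ) ∈ v.asIdeal →
      ∃ (g : Field.absoluteGaloisGroup (v.adicCompletion ℚ)) (c : ℕ → localPoints W (v.adicCompletion ℚ)),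
        κ.IsTopGenerator (resGalOfEmb (closureEmb (K := ℚ) (v.adicCompletion ℚ)) g) ∧
        (∀ n, c n ∈ localLayerPointsOfEmb κ (closureEmb (K := ℚ) (v.adicCompletion ℚ)) W n) ∧
        (∀ n, 1 ≤ n → localTraceOfEmb κ (closureEmb (K := ℚ) (v.adicCompletion ℚ)) W n (n + 1)
          (c (n + 1)) = W.frobeniusTrace 2 • c n - c (n - 1)) ∧
        (∀ z₀ : localLayerPointsOfEmb κ (closureEmb (K := ℚ) (v.adicCompletion ℚ)) W 0 →+ ℤ_[2],
          evalOn W (localLayerPointsOfEmb κ (closureEmb (K := ℚ) (v.adicCompletion ℚ)) W 0) z₀ (c 0) = 0 →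
            z₀ = 0) ∧
        (∀ a : ℤ_[2],
          (∃ z₀ : localLayerPointsOfEmb κ (closureEmb (K := ℚ) (v.adicCompletion ℚ)) W 0 →+ ℤ_[2],
            evalOn W (localLayerPointsOfEmb κ (closureEmb (K := ℚ) (v.adicCompletion ℚ)) W 0) z₀ (c 0) =
              2 * a) →
          ∃ y : localLayerPointsOfEmb κ (closureEmb (K := ℚ) (v.adicCompletion ℚ)) W 0 →+ ℤ_[2],
            evalOn W (localLayerPointsOfEmb κ (closureEmb (K := ℚ) (v.adicCompletion ℚ)) W 0) y (c 0) = a) ∧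
        (Finite (W.selmerGroupPInfty 2) →
          Finite (EndCoinvariants (conjSharpFlatSelmerInfty W κ (closureEmb (K := ℚ) (v.adicCompletion ℚ))
            (W.frobeniusTrace 2) g c .flat γ - 1)) →
          Nat.card (↥((sharpFlatSelmerInfty W κ (closureEmb (K := ℚ) (v.adicCompletion ℚ))
                (W.frobeniusTrace 2) g c .flat).comap (W.layerToInfty κ 0)) ⧸
              (W.selmerLayer κ 0).addSubgroupOf
                ((sharpFlatSelmerInfty W κ (closureEmb (K := ℚ) (v.adicCompletion ℚ))
                  (W.frobeniusTrace 2) g c .flat).comap (W.layerToInfty κ 0))) *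
            Nat.card (MulAction.fixedPoints (Field.absoluteGaloisGroup ℚ) (W.geomPrimaryTorsion 2)) =
          2 ^ (padicValNat 2 W.tamagawaProduct) *
            Nat.card (EndCoinvariants (conjSharpFlatSelmerInfty W κ
              (closureEmb (K := ℚ) (v.adicCompletion ℚ)) (W.frobeniusTrace 2) g c .flat γ - 1))) ∧
        (∀ [NeZero (W.conductorNorm ℤ)] (f : CuspForm (Gamma0 (W.conductorNorm ℤ)) 2),
            IsNewformOf W f → ∀ (ϖ : ℚ), (ϖ : ℝ) * W.realPeriodRat = plusPeriod f →
          ∀ (Ls Lf : IwasawaAlgebra 2), IsSprungPair f 2 (W.frobeniusTrace 2) Ls Lf →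
          ∀ (D : SharpFlatSelmerDualData W κ γ (closureEmb (K := ℚ) (v.adicCompletion ℚ))
              (W.frobeniusTrace 2) g c .flat) [ContinuousSMul ℤ_[2] (W.tateModule 2)],
            ∃ (I : Kato2004.IwasawaH1Data W 2 κ γ) (Y : W.FineSelmerDualData κ γ)
              (P : Submodule (IwasawaAlgebra 2) (IwasawaAlgebra 2))
              (loc : I.H →ₗ[IwasawaAlgebra 2] P) (toX : P →ₗ[IwasawaAlgebra 2] D.X)
              (δ : D.X →ₗ[IwasawaAlgebra 2] Y.X) (Z : Submodule (IwasawaAlgebra 2) I.H)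
              (G : IwasawaAlgebra 2),
              Function.Exact loc toX ∧ Function.Exact toX δ ∧
              G ∈ Submodule.map (P.subtype ∘ₗ loc) Z ∧
              iwasawaToPowerSeries 2 G = PowerSeries.C (ϖ : ℚ_[2]) * iwasawaToPowerSeries 2 Lf ∧
              (∀ 𝔭 : PrimeSpectrum (IwasawaAlgebra 2), 𝔭.asIdeal.height = 1 →
                PowerSeries.C (2 : ℤ_[2]) ∉ 𝔭.asIdeal →
                Literature.NumberTheory.EllipticCurves.Module.lengthAt (IwasawaAlgebra 2) Y.X 𝔭 ≤
                  Literature.NumberTheory.EllipticCurves.Module.lengthAt (IwasawaAlgebra 2) (I.H ⧸ Z) 𝔭) ∧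
              (TwoAdicSurjective W →
                ∀ 𝔭 : PrimeSpectrum (IwasawaAlgebra 2), 𝔭.asIdeal.height = 1 →
                  PowerSeries.C (2 : ℤ_[2]) ∈ 𝔭.asIdeal →
                  Literature.NumberTheory.EllipticCurves.Module.lengthAt (IwasawaAlgebra 2) Y.X 𝔭 ≤
                    Literature.NumberTheory.EllipticCurves.Module.lengthAt (IwasawaAlgebra 2) (I.H ⧸ Z) 𝔭)) := by
  sorry

/-- stub (2′): EVERY good-supersingular curve at `2` with `2`-adically NON-surjective image — `μ(X^♭(E/ℚ_∞)) = 0` for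
every local Coleman datum CARRYING EC♭@2 ∧ CK♭@2 (CONJECTURE / MATH-BOUND; habitat 2/208 `a₂ = 0` classes
`107217l`, `184041bk`; 0/549 `a₂ = ±2`). -/
theorem stub_allMuFlatOfNonSurj :
      ∀ (W : WeierstrassCurve ℚ) [W.IsElliptic] [W.IsGloballyMinimal],
      ¬ W.HasCM → W.analyticRank = 0 → GoodSS W 2 →
      ∀ (κ : ZpExtension ℚ 2) (γ : Field.absoluteGaloisGroup ℚ),
        κ.IsCyclotomic → κ.IsTopGenerator γ → IsCyclotomicVariable 2 γ →
      ∀ (v : HeightOneSpectrum (𝓞 ℚ)), (2 : 𝓞 ℚ) ∈ v.asIdeal →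
      ∀ (g : Field.absoluteGaloisGroup (v.adicCompletion ℚ)) (c : ℕ → localPoints W (v.adicCompletion ℚ)),
        κ.IsTopGenerator (resGalOfEmb (closureEmb (K := ℚ) (v.adicCompletion ℚ)) g) →
        (∀ (D : SharpFlatSelmerDualData W κ γ (closureEmb (K := ℚ) (v.adicCompletion ℚ))
            (W.frobeniusTrace 2) g c .flat) [Module.Finite (IwasawaAlgebra 2) D.X],
          Module.IsTorsion (IwasawaAlgebra 2) D.X →
          ∀ f : IwasawaAlgebra 2, D.charIdeal = Ideal.span {f} → Finite (W.selmerGroupPInfty 2) →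
            ∃ u : ℤ_[2]ˣ, ((PowerSeries.constantCoeff f : ℤ_[2]) : ℚ_[2]) =
              ((u : ℤ_[2]) : ℚ_[2]) * ((2 : ℕ) : ℚ_[2]) ^ (padicValNat 2 W.tamagawaProduct) *
                (Nat.card (W.selmerGroupPInfty 2) : ℚ_[2])) →
        (∀ [NeZero (W.conductorNorm ℤ)] (f : CuspForm (Gamma0 (W.conductorNorm ℤ)) 2),
            IsNewformOf W f → ∀ (ϖ : ℚ), (ϖ : ℝ) * W.realPeriodRat = plusPeriod f →
          ∀ (Ls Lf : IwasawaAlgebra 2), IsSprungPair f 2 (W.frobeniusTrace 2) Ls Lf →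
          ∀ (D : SharpFlatSelmerDualData W κ γ (closureEmb (K := ℚ) (v.adicCompletion ℚ))
              (W.frobeniusTrace 2) g c .flat) [ContinuousSMul ℤ_[2] (W.tateModule 2)],
            ∃ (I : Kato2004.IwasawaH1Data W 2 κ γ) (Y : W.FineSelmerDualData κ γ)
              (P : Submodule (IwasawaAlgebra 2) (IwasawaAlgebra 2))
              (loc : I.H →ₗ[IwasawaAlgebra 2] P) (toX : P →ₗ[IwasawaAlgebra 2] D.X)
              (δ : D.X →ₗ[IwasawaAlgebra 2] Y.X) (Z : Submodule (IwasawaAlgebra 2) I.H)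
              (G : IwasawaAlgebra 2),
              Function.Exact loc toX ∧ Function.Exact toX δ ∧
              G ∈ Submodule.map (P.subtype ∘ₗ loc) Z ∧
              iwasawaToPowerSeries 2 G = PowerSeries.C (ϖ : ℚ_[2]) * iwasawaToPowerSeries 2 Lf ∧
              (∀ 𝔭 : PrimeSpectrum (IwasawaAlgebra 2), 𝔭.asIdeal.height = 1 →
                PowerSeries.C (2 : ℤ_[2]) ∉ 𝔭.asIdeal →
                Literature.NumberTheory.EllipticCurves.Module.lengthAt (IwasawaAlgebra 2) Y.X 𝔭 ≤
                  Literature.NumberTheory.EllipticCurves.Module.lengthAt (IwasawaAlgebra 2) (I.H ⧸ Z) 𝔭) ∧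
              (TwoAdicSurjective W →
                ∀ 𝔭 : PrimeSpectrum (IwasawaAlgebra 2), 𝔭.asIdeal.height = 1 →
                  PowerSeries.C (2 : ℤ_[2]) ∈ 𝔭.asIdeal →
                  Literature.NumberTheory.EllipticCurves.Module.lengthAt (IwasawaAlgebra 2) Y.X 𝔭 ≤
                    Literature.NumberTheory.EllipticCurves.Module.lengthAt (IwasawaAlgebra 2) (I.H ⧸ Z) 𝔭)) →
        ¬ TwoAdicSurjective W →
          ∀ (D : SharpFlatSelmerDualData W κ γ (closureEmb (K := ℚ) (v.adicCompletion ℚ))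
              (W.frobeniusTrace 2) g c .flat) (g' : IwasawaAlgebra 2),
            D.charIdeal = Ideal.span {g'} → ¬ PowerSeries.C (2 : ℤ_[2]) ∣ g' := by
  sorry

/-- stub (3): EVERY curve of the crux — Miller's LOWER half `ord₂ #Ш_an ≤ ord₂ #Ш` (certificate-shaped per class:
CERT-CT2-X5ALL `Ш[2] ⊂ 2Ш[4]` ⇒ `2⁴ ∣ #Ш`, CERT-L3-CT42 beyond; conjecture-shaped as ∀). -/
theorem stub_allMillerLower :
    ∀ (W : WeierstrassCurve ℚ) [W.IsElliptic] [W.IsGloballyMinimal],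
      ¬ W.HasCM → W.analyticRank = 0 → GoodSS W 2 → MissingLowerBoundAt W 2 := by
  sorry

/-- composition = THE SKELETON: the crux BY NAME from exactly the five stubs (the two PUB slots paired), by the landed
`SSFlatRoad.supersingularRankZeroAtTwo_of_uniformFlatLine` (GEN 10); kernel-checked, no sorry of its own. -/
theorem SupersingularRankZeroAtTwo_of :
    Summit.BirchSwinnertonDyer.BirchSwinnertonDyer.Theses.ByReductionTypeAtTwo.SupersingularRankZeroAtTwo :=
  Summit.BirchSwinnertonDyer.BirchSwinnertonDyer.Theorems.SSFlatRoad.supersingularRankZeroAtTwo_of_uniformFlatLine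
    ⟨stub_ssPub, stub_katoPub⟩ stub_allFlatData stub_allMuFlatOfNonSurj stub_allMillerLower

end FlatUniformTwo

end Summit.BirchSwinnertonDyer.BirchSwinnertonDyer.Cruxes.SupersingularRankZeroAtTwo
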